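import Summits.Ventures.GridStability.Bench.WSCC9Deg4ATrajV2Deg4GE11o8T3o20EXACTRoa
import Summits.Ventures.GridStability.Bench.WSCC9Deg2ASPdampH12RoaModel
import Summits.Ventures.GridStability.Lyapunov.RecastAngleRecovery
import Summits.Ventures.GridStability.Lyapunov.ClassicalSwingForward
import Summits.Ventures.GridStability.Models.RecastAngles
import Mathlib.Analysis.SpecialFunctions.Trigonometric.Deriv
import Mathlib.Tactic.IntervalCases
import HarnessLib
-- PORT HOME/cert/sos-3/closer29200/gen_closer2.py (gridfusion-sos-3 g6) / sources WSCC9-deg4-A-trajV2-deg4-GE11o8-T3o20-EXACT.json sha256:b6593c9540996042 WSCC9-deg4-A-recertV1-deg4-GE11o8-kappa-incl-pp.json sha256:68f615735a25ed8b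

/-!
# «G1cct-WSCC9-LOWER-K ∀T ≤ 3/20 s» — the V₂ ROA (model half): no pole slip and return to synchronism FOR model-1's `WSCC9.postB_SPdamp.toModel`
# from sos-1's degree-4 STEP-2 certificate `Bench/WSCC9Deg4ATrajV2Deg4GE11o8T3o20EXACT` (level 18/17)

Venture GRIDFUSION, `plan/PARTITION.md` A2/A5/A6 (lead g8 RULING 9m (2)); seat gridfusion-sos-3 (g6). Sibling of
`WSCC9Deg4ATrajV2Deg4GE11o8T3o20EXACTRoa.lean` (recast half), which it imports. BRIDGE PATTERN of #62 (`WSCC9Deg4ASosgramDinstRoaModel.lean` p509956):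
it is the SAME MODEL, the SAME instance `WSCC9.postB_SPdamp : RecastData 2` (`Models/WSCC9.lean`) and the SAME exact embedding as the
file-of-record companion `WSCC9Deg2ASPdampH12RoaModel.lean` (gridfusion-lyap-1, p468745), so — instead of restating them — this file
IMPORTS that companion and REUSES its embedding vocabulary VERBATIM (`deg2_A_SPdampH12_Z`, `deg2_A_SPdampH12_Z_k`,
`deg2_A_SPdampH12_embed_k`, `deg2_A_SPdampH12_hasDerivWithinAt_Z`, `deg2_A_SPdampH12_Z_mem_M`); the only new facts are that the two
Bench files carry the same recast field and the same constraint set (`…_F_eq_F`, `…_M_eq_M`: both are model-1's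
`WSCC9.postB_SPdamp.polyField` / constraints VERBATIM, interface I2 — checked here by `simp` on the emitted `_eq` lemmas), the model-level
reading of the new certificate's sublevel piece (`…_model_roa`) and its well-posed form (`…_model_roa_wellPosed`, lyap-1's
`ClassicalSwing.existsUnique_and_forall` p520190 on lyap-2's `Models/ClassicalSwingGlobal` p518035).

THREE COLUMNS. CERTIFIED: the Bench identities of `WSCC9Deg4ATrajV2Deg4GE11o8T3o20EXACT` + the κ-companion `WSCC9Deg4ARecertV1Deg4GE11o8KappaInclPp` (consumed only through
`deg4_A_trajV2_deg4_GE11o8_T3o20_EXACT_roa_arcs`). MODELLED: every theorem here is about model-1's classical 3-machine model `WSCC9.postB_SPdamp.toModel`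
(`ClassicalSwing.field`: Anderson–Fouad (2.55)–(2.57) / Sauer–Pai (7.212)–(7.216) + speed damping (5.157), deviation coordinates,
exact rational data of instance WSCC9-postB-SPdamp-h12; MODEL-VALIDITY MV-2 + MV-P + MV-SPD + MV-ω + MV-h12: network-reduced with
constant-impedance loads, classical machines, uniform-ratio damping DECLARED, post-fault synchronous speed offset ω∞′) for equilibrium
angles `δs` with `WSCC9.postB_SPdamp.EqData δs`. VALIDATED (not in this file): sos-1's float arc reach 0.1575 s / RK4 CCT_sim ≈ 0.176 s. No sentence here says a grid is stable; «return to synchronism» below is a statement about solutions OF THE MODEL M′.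

STATEMENT (`deg4_A_trajV2_deg4_GE11o8_T3o20_EXACT_model_roa`): for every `0 < γ ≤ 18/17` and every solution `c` of the model on `[0, ∞)` whose recast
initial state satisfies `V ≤ γ` and whose initial relative-angle deviations satisfy `|u_i(0)| < π`: `V ≤ γ` along the recast state for
all `t ≥ 0`; no relative angle deviation ever reaches `±π` (no pole slip); every `u_i(t) → 0` and every speed deviation `ω_j(t) → 0`.
-/

namespace Summit.Ventures.GridStability.Bench.WSCC9

open Set Filter Metric Topology Real
open Summit.Ventures.GridStability.Lyapunov Summit.Ventures.GridStability.Models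
open Literature.Computation.Certificates Literature.Computation.Certificates.SOS

noncomputable section

/-- The two Bench files of the instance carry the SAME recast field (both = model-1's `WSCC9.postB_SPdamp.polyField` verbatim):
`deg4_A_trajV2_deg4_GE11o8_T3o20_EXACT_F = deg2_A_SPdampH12_F`. [folklore] -/
theorem deg4_A_trajV2_deg4_GE11o8_T3o20_EXACT_F_eq_F : deg4_A_trajV2_deg4_GE11o8_T3o20_EXACT_F = deg2_A_SPdampH12_F := by
  funext z i
  fin_cases i <;>
    simp [deg4_A_trajV2_deg4_GE11o8_T3o20_EXACT_F, deg2_A_SPdampH12_F,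
      deg4_A_trajV2_deg4_GE11o8_T3o20_EXACT_f_sigma_2_eq, deg4_A_trajV2_deg4_GE11o8_T3o20_EXACT_f_kappa_2_eq, deg4_A_trajV2_deg4_GE11o8_T3o20_EXACT_f_sigma_3_eq, deg4_A_trajV2_deg4_GE11o8_T3o20_EXACT_f_kappa_3_eq, deg4_A_trajV2_deg4_GE11o8_T3o20_EXACT_f_omega_1_eq, deg4_A_trajV2_deg4_GE11o8_T3o20_EXACT_f_omega_2_eq, deg4_A_trajV2_deg4_GE11o8_T3o20_EXACT_f_omega_3_eq,
      deg2_A_SPdampH12_f_sigma_2_eq, deg2_A_SPdampH12_f_kappa_2_eq, deg2_A_SPdampH12_f_sigma_3_eq, deg2_A_SPdampH12_f_kappa_3_eq, deg2_A_SPdampH12_f_omega_1_eq, deg2_A_SPdampH12_f_omega_2_eq, deg2_A_SPdampH12_f_omega_3_eq]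

/-- … and the SAME constraint set `{h₁ = 0, h₂ = 0}`: `deg4_A_trajV2_deg4_GE11o8_T3o20_EXACT_M = deg2_A_SPdampH12_M`. [folklore] -/
theorem deg4_A_trajV2_deg4_GE11o8_T3o20_EXACT_M_eq_M : deg4_A_trajV2_deg4_GE11o8_T3o20_EXACT_M = deg2_A_SPdampH12_M := by
  ext z
  simp only [deg4_A_trajV2_deg4_GE11o8_T3o20_EXACT_M, deg2_A_SPdampH12_M, mem_setOf_eq,
    deg4_A_trajV2_deg4_GE11o8_T3o20_EXACT_h1_eq, deg4_A_trajV2_deg4_GE11o8_T3o20_EXACT_h2_eq, deg2_A_SPdampH12_h1_eq, deg2_A_SPdampH12_h2_eq]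

/-- **Exact embedding along solutions of the model `M′`** for THIS Bench field: the recast curve `t ↦ Z δs (c t)` (lyap-1's
`deg2_A_SPdampH12_Z`, = model-1's `RecastData.embed`) solves `ż = F(z)` with `deg4_A_trajV2_deg4_GE11o8_T3o20_EXACT_F` — from the file-of-record companion's
`deg2_A_SPdampH12_hasDerivWithinAt_Z` and `…_F_eq_F`. [folklore] -/
theorem deg4_A_trajV2_deg4_GE11o8_T3o20_EXACT_hasDerivWithinAt_Z {δs : Fin 3 → ℝ} (hEq : WSCC9.postB_SPdamp.EqData δs)
    {c : ℝ → ClassicalSwing.State 3} {s : Set ℝ} (hc : WSCC9.postB_SPdamp.toModel.IsSolutionOn c s)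
    {t : ℝ} (ht : t ∈ s) :
    HasDerivWithinAt (fun τ ↦ deg2_A_SPdampH12_Z δs (c τ))
      (deg4_A_trajV2_deg4_GE11o8_T3o20_EXACT_F (deg2_A_SPdampH12_Z δs (c t))) s t := by
  rw [deg4_A_trajV2_deg4_GE11o8_T3o20_EXACT_F_eq_F]
  exact deg2_A_SPdampH12_hasDerivWithinAt_Z hEq hc ht

/-- The recast coordinates of any state lie on THIS file's constraint set `M`. [folklore] -/
theorem deg4_A_trajV2_deg4_GE11o8_T3o20_EXACT_Z_mem_M (δs : Fin 3 → ℝ) (x : ClassicalSwing.State 3) :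
    deg2_A_SPdampH12_Z δs x ∈ deg4_A_trajV2_deg4_GE11o8_T3o20_EXACT_M := by
  rw [deg4_A_trajV2_deg4_GE11o8_T3o20_EXACT_M_eq_M]
  exact deg2_A_SPdampH12_Z_mem_M δs x

/-- **New-V ROA in original coordinates (3-machine WSCC9), with angle recovery (A6).** MODELLED: model-1's classical model
`WSCC9.postB_SPdamp.toModel` for equilibrium angles `δs` satisfying `WSCC9.postB_SPdamp.EqData δs`. CERTIFIED inputs: the
kernel-checked identities of the two Bench files (consumed by `deg4_A_trajV2_deg4_GE11o8_T3o20_EXACT_roa_arcs`). STATEMENT: for every `0 < γ ≤ c = 18/17` and every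
solution `c(t)` on `[0, ∞)` whose recast initial state has `V ≤ γ` and whose initial relative-angle deviations satisfy `|u_i(0)| < π`:
`V ≤ γ` along the recast state for all `t ≥ 0`; NO relative angle ever reaches `±π` (no pole slip); every `u_i(t) → 0` and every
speed deviation `ω_j(t) → 0` (return to synchronism at the equilibrium `δs`). No sentence here says a grid is stable. [folklore] -/
theorem deg4_A_trajV2_deg4_GE11o8_T3o20_EXACT_model_roa {δs : Fin 3 → ℝ} (hEq : WSCC9.postB_SPdamp.EqData δs)
    {γ : ℝ} (hγ0 : 0 < γ) (hγ : γ ≤ deg4_A_trajV2_deg4_GE11o8_T3o20_EXACT_level)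
    {c : ℝ → ClassicalSwing.State 3} (hc : WSCC9.postB_SPdamp.toModel.IsSolutionOn c (Ici 0))
    (h0V : deg4_A_trajV2_deg4_GE11o8_T3o20_EXACT_Vz (deg2_A_SPdampH12_Z δs (c 0)) ≤ γ)
    (h0win : ∀ i : Fin 2, |RecastData.u δs (c 0) i.succ| < π) :
    (∀ t, 0 ≤ t → deg4_A_trajV2_deg4_GE11o8_T3o20_EXACT_Vz (deg2_A_SPdampH12_Z δs (c t)) ≤ γ) ∧
    (∀ i : Fin 2, ∀ t, 0 ≤ t → |RecastData.u δs (c t) i.succ| < π) ∧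
    (∀ i : Fin 2, Tendsto (fun t ↦ RecastData.u δs (c t) i.succ) atTop (𝓝 0)) ∧
    (∀ j : Fin 3, Tendsto (fun t ↦ (c t).2 j) atTop (𝓝 0)) := by
  set z : ℝ → Fin 7 → ℝ := fun τ ↦ deg2_A_SPdampH12_Z δs (c τ) with hzdef
  have hcc : ContinuousOn c (Ici 0) := fun t ht ↦ (hc t ht).continuousWithinAt
  have hzc : ContinuousOn z (Ici 0) := by
    have h : Continuous fun x : ClassicalSwing.State 3 ↦ deg2_A_SPdampH12_Z δs x := by
      refine continuous_pi fun k ↦ ?_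
      fin_cases k <;> simp [deg2_A_SPdampH12_Z_0, deg2_A_SPdampH12_Z_1, deg2_A_SPdampH12_Z_2,
        deg2_A_SPdampH12_Z_3, deg2_A_SPdampH12_Z_4, deg2_A_SPdampH12_Z_5, deg2_A_SPdampH12_Z_6,
        RecastData.u] <;> fun_prop
    exact h.comp_continuousOn hcc
  have hz : ∀ t, 0 ≤ t → HasDerivWithinAt z (deg4_A_trajV2_deg4_GE11o8_T3o20_EXACT_F (z t)) (Ici t) t := fun t ht ↦
    (deg4_A_trajV2_deg4_GE11o8_T3o20_EXACT_hasDerivWithinAt_Z hEq hc ht).mono (Ici_subset_Ici.2 ht)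
  obtain ⟨hinv, hlim⟩ := deg4_A_trajV2_deg4_GE11o8_T3o20_EXACT_roa_arcs hγ0 hγ hzc hz (deg4_A_trajV2_deg4_GE11o8_T3o20_EXACT_Z_mem_M δs (c 0)) h0V
  -- per-coordinate limits of model-1's `embed`
  have hlim' : ∀ k : ℕ, k < 7 → Tendsto (fun t ↦ RecastData.embed δs (c t) k) atTop (𝓝 0) := by
    intro k hk
    have hall := tendsto_pi_nhds.1 hlim
    interval_cases k
    · simpa [hzdef, deg2_A_SPdampH12_embed_0] using hall 0
    · simpa [hzdef, deg2_A_SPdampH12_embed_1] using hall 1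
    · simpa [hzdef, deg2_A_SPdampH12_embed_2] using hall 2
    · simpa [hzdef, deg2_A_SPdampH12_embed_3] using hall 3
    · simpa [hzdef, deg2_A_SPdampH12_embed_4] using hall 4
    · simpa [hzdef, deg2_A_SPdampH12_embed_5] using hall 5
    · simpa [hzdef, deg2_A_SPdampH12_embed_6] using hall 6
  -- arc bounds `κ_i ≤ 3/2 < 2` along the curve (from the κ-companion's containment identities)
  have hκ : ∀ i : Fin 2, ∀ t, 0 ≤ t → RecastData.embed δs (c t) (2 * i.val + 1) < 2 := by
    intro i t ht
    obtain ⟨-, harc⟩ := hinv t ht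
    fin_cases i
    · have h := harc
      simp only [hzdef, deg2_A_SPdampH12_Z_1, deg2_A_SPdampH12_Z_3] at h
      show RecastData.embed δs (c t) 1 < 2
      rw [deg2_A_SPdampH12_embed_1]
      linarith [h.1]
    · have h := harc
      simp only [hzdef, deg2_A_SPdampH12_Z_1, deg2_A_SPdampH12_Z_3] at h
      show RecastData.embed δs (c t) 3 < 2
      rw [deg2_A_SPdampH12_embed_3]
      linarith [h.2]
  have hrec := recast_angle_recovery δs hcc hlim' hκ h0win
  exact ⟨fun t ht ↦ (hinv t ht).1, hrec.1, hrec.2.1, hrec.2.2⟩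

/-- **New-V ROA, well-posed form (∃!)** at the canonical angles `WSCC9.postB_SPdamp.angleOf`. For every `0 < γ ≤ 18/17` and every
MACHINE STATE `x₀` of M′ with `V(Z x₀) ≤ γ` and `|u_i(x₀)| < π` (`i = 1, 2`): (i) there is EXACTLY ONE solution of
`WSCC9.postB_SPdamp.toModel` on all of `ℝ` with `c 0 = x₀` (lyap-2 `Models/ClassicalSwingGlobal` p518035 / lyap-1
`ClassicalSwing.existsUnique_and_forall` p520190), and (ii) every such solution keeps `V(Z (c t)) ≤ γ` for all `t ≥ 0`, never
pole-slips, and has `u_i(t) → 0`, `ω_j(t) → 0`. MODELLED/CERTIFIED columns as in the module docstring. [folklore] -/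
theorem deg4_A_trajV2_deg4_GE11o8_T3o20_EXACT_model_roa_wellPosed {γ : ℝ} (hγ0 : 0 < γ) (hγ : γ ≤ deg4_A_trajV2_deg4_GE11o8_T3o20_EXACT_level) {x₀ : ClassicalSwing.State 3}
    (hV : deg4_A_trajV2_deg4_GE11o8_T3o20_EXACT_Vz (deg2_A_SPdampH12_Z WSCC9.postB_SPdamp.angleOf x₀) ≤ γ)
    (hwin : ∀ i : Fin 2, |RecastData.u WSCC9.postB_SPdamp.angleOf x₀ i.succ| < π) :
    (∃! c : ℝ → ClassicalSwing.State 3, c 0 = x₀ ∧ WSCC9.postB_SPdamp.toModel.IsSolutionOn c univ) ∧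
    ∀ c : ℝ → ClassicalSwing.State 3, c 0 = x₀ → WSCC9.postB_SPdamp.toModel.IsSolutionOn c univ →
      (∀ t, 0 ≤ t → deg4_A_trajV2_deg4_GE11o8_T3o20_EXACT_Vz (deg2_A_SPdampH12_Z WSCC9.postB_SPdamp.angleOf (c t)) ≤ γ) ∧
      (∀ i : Fin 2, ∀ t, 0 ≤ t → |RecastData.u WSCC9.postB_SPdamp.angleOf (c t) i.succ| < π) ∧
      (∀ i : Fin 2, Tendsto (fun t ↦ RecastData.u WSCC9.postB_SPdamp.angleOf (c t) i.succ) atTop (𝓝 0)) ∧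
      (∀ j : Fin 3, Tendsto (fun t ↦ (c t).2 j) atTop (𝓝 0)) :=
  ClassicalSwing.existsUnique_and_forall WSCC9.postB_SPdamp.toModel
    (I := fun x ↦ deg4_A_trajV2_deg4_GE11o8_T3o20_EXACT_Vz (deg2_A_SPdampH12_Z WSCC9.postB_SPdamp.angleOf x) ≤ γ ∧
      ∀ i : Fin 2, |RecastData.u WSCC9.postB_SPdamp.angleOf x i.succ| < π)
    (fun _ hc hI ↦ deg4_A_trajV2_deg4_GE11o8_T3o20_EXACT_model_roa WSCC9.postB_SPdamp_eqData hγ0 hγ (hc.mono (subset_univ _)) hI.1 hI.2) ⟨hV, hwin⟩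

end

end Summit.Ventures.GridStability.Bench.WSCC9
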